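import Literature.MathematicalPhysics.QuantumLattice.HubbardNNNHoppingPlaquetteFlux
import Literature.MathematicalPhysics.QuantumLattice.PairFieldBoost
import Literature.MathematicalPhysics.QuantumLattice.PinningFieldPairingOrder
import HarnessLib

/-!
# The pair-sourced `t–t'` Hubbard torus under a FLAT TWIST, and its gauge picture: untwisted hopping with a
# SPIRAL (Fulde–Ferrell) pair source — the finite-torus gauge identity of the sourced-helicity chord

Topic `Literature/MathematicalPhysics/QuantumLattice` (namespace = path; family `hubbard`). Companion of
`PairFieldBoost.lean` (the one-dimensional Bloch/LSM boost `W_k = phaseGauge (x ↦ e(k x₁))`: boosted Hamiltonian =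
uniformly twisted torus, boost shifts the pair momentum by `2k`), `HubbardNNNHoppingFlux(Gauge…).lean` / the
plaquette-flux files (gauge covariance of `magneticHubbardTorus` and of the diagonal Peierls sum
`diagPeierlsHopping`) and `DWaveSourceNNNHopping.lean` (`dWaveSourceTorusTT' L t' U μ h`). It is the object `D1`
and the support item `P2` of the Hubbard cuprate cell's row T8 «sourced helicity chord» (`hubbard-cq`, card
`sourced-helicity-chord`): the `t–t'–U` torus with the SAME constant phase `χ(n·e)` (`χ = e^{2πi·/L}`, `n ∈ (ℤ/L)²`,
i.e. twist wave vector `q = 4πn/L`) on every bond `x → x + e` — nearest AND next-nearest neighbours, both spins —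
minus `μN` and minus the UNTWISTED `d`-wave pair source `h(Δ_d + Δ_d†)`. Because a flat twist with trivial
holonomy is a pure gauge, conjugating by the two-dimensional boost `W_n = phaseGauge (x ↦ χ(n·x))` removes the
twist from the hopping and turns the uniform pair source into the SPIRAL source of pair momentum `2n`.
Everything is PROVED; the `def`s are the only new objects.

## Contents

* `boostPhase2 L n x = χ(n·x)`, `flatTwistConfig L n` (`χ(n_i)` on every `e_i`-edge), `flatTwistDiagAmp L n`
  (`χ(n·j_s)` on the diagonal bond `x → x + j_s`), `hubbardTorusTT'Twist L t' U n`,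
  **`dWaveSourceTorusTT'Twist L t' U μ h n`** (the T8 object), `spiralLocalPair g L n x`
  (`Σ_e (g e/√2) χ(n·e) d_{x,x+e}`) and **`spiralPairField g L n = Σ_x χ(2n·x) · spiralLocalPair`** (the
  Fulde–Ferrell pair source of pair momentum `2n`).
* PURE GAUGE: `gaugeTransform_twistPhase_flatTwistConfig` (`(flatTwist)^{χ(n·x)} = 1`),
  `twistPhase_mul_flatTwistDiagAmp_mul_conj` (the diagonal phases are removed too); hence
  **`conj_hubbardTorusTT'Twist`**: `W_nᴴ H^{tt'}_{twist n} W_n = hubbardTorusTT' L 1 t' U` (`L ≥ 3`).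
* SOURCE ROTATION: `conj_bondPairAnn_twistPhase`, `conj_localPair_twistPhase`,
  **`conj_pairField_eq_spiralPairField`**: `W_nᴴ Δ_g W_n = spiralPairField g L n`.
* **`conj_dWaveSourceTorusTT'Twist`** (THE GAUGE IDENTITY, `L ≥ 3`):
  `W_nᴴ · dWaveSourceTorusTT'Twist L t' U μ h n · W_n = (hubbardTorusTT' L 1 t' U − μN) − h(Δ^{(2n)} + Δ^{(2n)†})`,
  `Δ^{(2n)} = spiralPairField dWaveFormFactor L n`; `minEnergyOn_szSector_dWaveSourceTorusTT'Twist` (equal sector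
  energies); at `h = 0`: **`minEnergyOn_szSector_dWaveSourceTorusTT'Twist_zero_source`** — a flat twist with trivial
  holonomy is INVISIBLE without source, `E_{(N,S^z)}(twist n, h = 0) = E_{(N,S^z)}(dWaveSourceTorusTT' L t' U μ 0)`
  (the hypothesis `gauge0` of obst-1's sketch is a theorem); and at `n = 0` the twist is absent
  (`dWaveSourceTorusTT'Twist_zero_twist`).
* Symmetries: Hermitian, conserves `N` and `S^z`.

HONEST SCOPE: finite-volume definitions and gauge bookkeeping for a W1-type sourced word; no number, no
thermodynamic limit, nothing about superconductivity; twists with non-trivial holonomy (`q ∉ (4π/L)ℤ²`) are NOT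
pure gauges and are not treated here (that is the seam-flux family `hubbardTorusTT'Flux`).

## References
* H. Watanabe, J. Stat. Phys. 177 (2019) 717, §2.2.1–§2.2.3 (twist operators, `U H U†`, pure gauges).
  [cite: Watanabe2019, §2.2.1]
* D. Bohm, Phys. Rev. 75 (1949) 502 (boosted states). [cite: Bohm1949]
* P. Fulde, R. A. Ferrell, Phys. Rev. 135 (1964) A550, §II (pairing with finite centre-of-mass momentum).
  [cite: KomaTasaki1994, §1]
* T. Koma, H. Tasaki, PRL 68 (1992) 3248, eqs. (5)–(8) (site-phase unitaries). [cite: KomaTasakiPRL1992, eqs. (7)–(8)]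
-/

noncomputable section

namespace Literature.MathematicalPhysics.QuantumLattice

open _root_.Matrix Finset Literature.MathematicalPhysics.QuantumFieldTheory Literature.Probability.LatticeModels
  HubbardWave0
open scoped ComplexConjugate

variable (L : ℕ) [NeZero L]

/-! ### The objects -/

/-- The **two-dimensional boost phase** `x ↦ χ(n·x) = e^{2πi(n₁x₁+n₂x₂)/L}` (`n ∈ (ℤ/L)²`).
[cite: Watanabe2019, §2.2.1] -/
def boostPhase2 (n : Fin 2 → ZMod L) (x : TorusSite 2 L) : Circle := ZMod.toCircle (n 0 * x 0 + n 1 * x 1)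

/-- The **flat twist** gauge field: the constant phase `χ(n_i)` on every `e_i`-edge (flat, holonomy
`χ(n_i)^L = 1` — a pure gauge). [cite: Watanabe2019, §2.2.1] -/
def flatTwistConfig (n : Fin 2 → ZMod L) : GaugeConfig 2 L Circle := fun e => ZMod.toCircle (n e.2)

/-- The flat twist on the diagonal bonds: the constant amplitude `χ(n·j_s)` on `x → x + j_s`
(`j₀ = e₁ + e₂`, `j₁ = e₁ − e₂`). [cite: Watanabe2019, §2.2.1] -/
def flatTwistDiagAmp (n : Fin 2 → ZMod L) : Fin 2 → Site 2 L → ℂ :=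
  fun s _ => ((ZMod.toCircle (n 0 * torusDiagJump L s 0 + n 1 * torusDiagJump L s 1) : Circle) : ℂ)

/-- **The `t–t'` Hubbard torus under the flat twist `n`** (`t = 1`): every nearest-neighbour hop `x → x + e_i`
carries `χ(n_i)`, every diagonal hop `x → x + j_s` carries `χ(n·j_s)`. [cite: Watanabe2019, §2.2.1] -/
def hubbardTorusTT'Twist (t' U : ℝ) (n : Fin 2 → ZMod L) :
    Matrix (Finset (Orb (FermionTorus 2 L))) (Finset (Orb (FermionTorus 2 L))) ℂ :=
  magneticHubbardTorus L (flatTwistConfig L n) 1 U + -(t' : ℂ) • diagPeierlsHopping L (flatTwistDiagAmp L n)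

/-- **The pair-sourced `t–t'` torus under the flat twist** (the T8 object `H(h, q)`, `q = 4πn/L`): twisted
hopping, `−μN`, and the UNTWISTED `d`-wave source `−h(Δ_d + Δ_d†)`. [cite: KomaTasaki1994, §1] -/
def dWaveSourceTorusTT'Twist (t' U μ h : ℝ) (n : Fin 2 → ZMod L) :
    Matrix (Finset (Orb (FermionTorus 2 L))) (Finset (Orb (FermionTorus 2 L))) ℂ :=
  (hubbardTorusTT'Twist L t' U n - (μ : ℂ) • totalNumber) -
    (h : ℂ) • (pairField dWaveFormFactor L + (pairField dWaveFormFactor L)ᴴ)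

/-- The **bond-twisted local pair** `P_x^{(n)} = Σ_{e ∈ {0,±e₁,±e₂}} (g e/√2) χ(n·e) d_{x,x+e}`.
[cite: Bohm1949] -/
def spiralLocalPair (g : Site 2 → ℝ) (n : Fin 2 → ZMod L) (x : TorusSite 2 L) :
    Matrix (Finset (Orb (FermionTorus 2 L))) (Finset (Orb (FermionTorus 2 L))) ℂ :=
  ∑ e ∈ insert (0 : Site 2) unitSteps, ((g e / Real.sqrt 2 : ℝ) : ℂ) •
    ((ZMod.stdAddChar (n 0 * Torus.proj L e 0 + n 1 * Torus.proj L e 1) : ℂ) •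
      bondPairAnn (FermionTorus.ofTorusSite x) (FermionTorus.ofTorusSite (x + Torus.proj L e)))

/-- The **spiral (Fulde–Ferrell) pair source of pair momentum `2n`**: `Δ_g^{(2n)} = Σ_x χ(2n·x) P_x^{(n)}`.
[cite: Bohm1949] -/
def spiralPairField (g : Site 2 → ℝ) (n : Fin 2 → ZMod L) :
    Matrix (Finset (Orb (FermionTorus 2 L))) (Finset (Orb (FermionTorus 2 L))) ℂ :=
  ∑ x : TorusSite 2 L, (ZMod.stdAddChar ((n 0 + n 0) * x 0 + (n 1 + n 1) * x 1) : ℂ) • spiralLocalPair L g n x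

/-! ### The flat twist is a pure gauge -/

/-- `χ(n·x)` in `ℂ` is the standard additive character. [folklore] -/
private theorem coe_twistPhase (n : Fin 2 → ZMod L) (x : TorusSite 2 L) :
    ((boostPhase2 L n x : Circle) : ℂ) = ZMod.stdAddChar (n 0 * x 0 + n 1 * x 1) := rfl

omit [NeZero L] in
/-- Coordinates of a shifted site. [folklore] -/
private theorem shift_apply (x : Site 2 L) (i j : Fin 2) : (x.shift i) j = x j + if j = i then 1 else 0 := by
  simp [Literature.MathematicalPhysics.QuantumFieldTheory.Site.shift, Pi.single_apply]

/-- **The boost gauges the flat twist away**: `gaugeTransform (χ(n·)) (flatTwistConfig L n) = 1`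
(`χ(n·x) χ(n_i) χ(n·(x+e_i))⁻¹ = 1`). [cite: Watanabe2019, §2.2.1] -/
theorem gaugeTransform_twistPhase_flatTwistConfig (n : Fin 2 → ZMod L) :
    gaugeTransform (boostPhase2 L n) (flatTwistConfig L n) = 1 := by
  funext e
  obtain ⟨x, i⟩ := e
  simp only [gaugeTransform, boostPhase2, flatTwistConfig, Pi.one_apply]
  rw [shift_apply, shift_apply, ← AddChar.map_add_eq_mul, ← AddChar.map_neg_eq_inv, ← AddChar.map_add_eq_mul,
    ← AddChar.map_zero_eq_one (ZMod.toCircle (N := L))]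
  congr 1
  by_cases hi : i = 0
  · subst hi; simp; ring
  · obtain rfl : i = 1 := Fin.eq_one_of_ne_zero i hi
    simp; ring

omit [NeZero L] in
/-- Coordinates of a site moved by a diagonal jump. [folklore] -/
private theorem add_torusDiagJump_apply (x : Site 2 L) (s j : Fin 2) :
    (x + torusDiagJump L s) j = x j + torusDiagJump L s j := rfl

/-- **… and the diagonal twist too**: `χ(n·x) · χ(n·j_s) · conj χ(n·(x + j_s)) = 1`. [cite: Watanabe2019, §2.2.1] -/
theorem twistPhase_mul_flatTwistDiagAmp_mul_conj (n : Fin 2 → ZMod L) (s : Fin 2) (x : Site 2 L) :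
    (boostPhase2 L n x : ℂ) * flatTwistDiagAmp L n s x * conj ((boostPhase2 L n (x + torusDiagJump L s) : Circle) : ℂ) = 1 := by
  rw [flatTwistDiagAmp, ← Circle.coe_inv_eq_conj, ← Circle.coe_mul, ← Circle.coe_mul, ← Circle.coe_one]
  congr 1
  simp only [boostPhase2, add_torusDiagJump_apply]
  rw [← AddChar.map_add_eq_mul, ← AddChar.map_neg_eq_inv, ← AddChar.map_add_eq_mul,
    ← AddChar.map_zero_eq_one (ZMod.toCircle (N := L))]
  congr 1
  ring

/-- **The boosted twisted torus is the untwisted one** (`L ≥ 3`):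
`W_nᴴ · hubbardTorusTT'Twist L t' U n · W_n = hubbardTorusTT' L 1 t' U`, `W_n = phaseGauge (χ(n·))`.
[cite: Watanabe2019, §2.2.1] -/
theorem conj_hubbardTorusTT'Twist (hL : 3 ≤ L) (t' U : ℝ) (n : Fin 2 → ZMod L) :
    (phaseGauge fun u : FermionTorus 2 L => boostPhase2 L n u.toTorusSite)ᴴ * hubbardTorusTT'Twist L t' U n *
        phaseGauge (fun u : FermionTorus 2 L => boostPhase2 L n u.toTorusSite) = hubbardTorusTT' L 1 t' U := by
  rw [hubbardTorusTT'Twist, Matrix.mul_add, Matrix.add_mul, ← magneticHubbardTorus_gaugeTransform,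
    gaugeTransform_twistPhase_flatTwistConfig, Matrix.mul_smul, Matrix.smul_mul,
    conjTranspose_phaseGauge_mul_diagPeierlsHopping_mul_phaseGauge, hubbardTorusTT'_eq_magneticHubbardTorus_add_diag hL]
  simp only [twistPhase_mul_flatTwistDiagAmp_mul_conj]

/-! ### The boost rotates the pair source into a spiral -/

/-- **Boost of one bond pair**: `W_nᴴ d_{x,x+e} W_n = χ(2n·x) χ(n·e) d_{x,x+e}`. [cite: Bohm1949] -/
theorem conj_bondPairAnn_twistPhase (n : Fin 2 → ZMod L) (x : TorusSite 2 L) (e : Site 2) :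
    (phaseGauge fun u : FermionTorus 2 L => boostPhase2 L n u.toTorusSite)ᴴ *
        bondPairAnn (FermionTorus.ofTorusSite x) (FermionTorus.ofTorusSite (x + Torus.proj L e)) *
        phaseGauge (fun u : FermionTorus 2 L => boostPhase2 L n u.toTorusSite) =
      ((ZMod.stdAddChar ((n 0 + n 0) * x 0 + (n 1 + n 1) * x 1) : ℂ) *
          ZMod.stdAddChar (n 0 * Torus.proj L e 0 + n 1 * Torus.proj L e 1)) •
        bondPairAnn (FermionTorus.ofTorusSite x) (FermionTorus.ofTorusSite (x + Torus.proj L e)) := by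
  rw [conjTranspose_phaseGauge_mul_bondPairAnn_mul_phaseGauge, FermionTorus.toTorusSite_ofTorusSite,
    FermionTorus.toTorusSite_ofTorusSite, coe_twistPhase, coe_twistPhase, Pi.add_apply, Pi.add_apply,
    ← AddChar.map_add_eq_mul, ← AddChar.map_add_eq_mul,
    show n 0 * x 0 + n 1 * x 1 + (n 0 * (x 0 + Torus.proj L e 0) + n 1 * (x 1 + Torus.proj L e 1)) =
      (n 0 + n 0) * x 0 + (n 1 + n 1) * x 1 + (n 0 * Torus.proj L e 0 + n 1 * Torus.proj L e 1) by ring]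

/-- **Boost of the local pair**: `W_nᴴ P_x W_n = χ(2n·x) P_x^{(n)}`. [cite: Bohm1949] -/
theorem conj_localPair_twistPhase (g : Site 2 → ℝ) (n : Fin 2 → ZMod L) (x : TorusSite 2 L) :
    (phaseGauge fun u : FermionTorus 2 L => boostPhase2 L n u.toTorusSite)ᴴ * localPair g L x *
        phaseGauge (fun u : FermionTorus 2 L => boostPhase2 L n u.toTorusSite) =
      (ZMod.stdAddChar ((n 0 + n 0) * x 0 + (n 1 + n 1) * x 1) : ℂ) • spiralLocalPair L g n x := by
  rw [localPair_eq_sum_bondPairAnn, spiralLocalPair, Finset.mul_sum, Finset.sum_mul, Finset.smul_sum]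
  refine Finset.sum_congr rfl fun e _ => ?_
  rw [Matrix.mul_smul, Matrix.smul_mul, conj_bondPairAnn_twistPhase, ← smul_smul]
  exact smul_comm _ _ _

/-- **The boost turns the uniform pair field into the spiral one**: `W_nᴴ Δ_g W_n = Δ_g^{(2n)}`. [cite: Bohm1949] -/
theorem conj_pairField_eq_spiralPairField (g : Site 2 → ℝ) (n : Fin 2 → ZMod L) :
    (phaseGauge fun u : FermionTorus 2 L => boostPhase2 L n u.toTorusSite)ᴴ * pairField g L *
        phaseGauge (fun u : FermionTorus 2 L => boostPhase2 L n u.toTorusSite) = spiralPairField L g n := by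
  rw [pairField, spiralPairField, Finset.mul_sum, Finset.sum_mul]
  exact Finset.sum_congr rfl fun x _ => by rw [conj_localPair_twistPhase]

/-- The adjoint source rotates accordingly: `W_nᴴ Δ_gᴴ W_n = (Δ_g^{(2n)})ᴴ`. [cite: Bohm1949] -/
theorem conj_pairField_conjTranspose_eq (g : Site 2 → ℝ) (n : Fin 2 → ZMod L) :
    (phaseGauge fun u : FermionTorus 2 L => boostPhase2 L n u.toTorusSite)ᴴ * (pairField g L)ᴴ *
        phaseGauge (fun u : FermionTorus 2 L => boostPhase2 L n u.toTorusSite) = (spiralPairField L g n)ᴴ := by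
  rw [← conj_pairField_eq_spiralPairField, conjTranspose_mul, conjTranspose_mul, conjTranspose_conjTranspose,
    Matrix.mul_assoc]

/-! ### The gauge identity of the sourced twisted torus -/

/-- `W_nᴴ N W_n = N`. [cite: KomaTasakiPRL1992, eqs. (7)–(8)] -/
private theorem conj_totalNumber_twistPhase (n : Fin 2 → ZMod L) :
    (phaseGauge fun u : FermionTorus 2 L => boostPhase2 L n u.toTorusSite)ᴴ * totalNumber *
        phaseGauge (fun u : FermionTorus 2 L => boostPhase2 L n u.toTorusSite) = totalNumber := by
  have hW : (phaseGauge fun u : FermionTorus 2 L => boostPhase2 L n u.toTorusSite) =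
      (phaseGauge fun u : FermionTorus 2 L => (boostPhase2 L n u.toTorusSite)⁻¹)ᴴ := by
    rw [phaseGauge_conjTranspose]
    congr 1
    funext u
    simp only [Pi.inv_apply, inv_inv]
  rw [hW, conjTranspose_conjTranspose]
  exact phaseGauge_mul_totalNumber_mul_conjTranspose _

/-- **THE GAUGE IDENTITY** (`L ≥ 3`): the twisted-hopping, uniformly sourced torus is unitarily the untwisted
torus with the SPIRAL pair source of pair momentum `2n`:
`W_nᴴ · dWaveSourceTorusTT'Twist L t' U μ h n · W_n = (hubbardTorusTT' L 1 t' U − μN) − h(Δ_d^{(2n)} + Δ_d^{(2n)†})`.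
[cite: Watanabe2019, §2.2.1] -/
theorem conj_dWaveSourceTorusTT'Twist (hL : 3 ≤ L) (t' U μ h : ℝ) (n : Fin 2 → ZMod L) :
    (phaseGauge fun u : FermionTorus 2 L => boostPhase2 L n u.toTorusSite)ᴴ * dWaveSourceTorusTT'Twist L t' U μ h n *
        phaseGauge (fun u : FermionTorus 2 L => boostPhase2 L n u.toTorusSite) =
      (hubbardTorusTT' L 1 t' U - (μ : ℂ) • totalNumber) -
        (h : ℂ) • (spiralPairField L dWaveFormFactor n + (spiralPairField L dWaveFormFactor n)ᴴ) := by
  rw [dWaveSourceTorusTT'Twist, Matrix.mul_sub, Matrix.sub_mul, Matrix.mul_sub, Matrix.sub_mul,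
    conj_hubbardTorusTT'Twist L hL, Matrix.mul_smul, Matrix.smul_mul, conj_totalNumber_twistPhase,
    Matrix.mul_smul, Matrix.smul_mul, Matrix.mul_add, Matrix.add_mul, conj_pairField_eq_spiralPairField,
    conj_pairField_conjTranspose_eq]

/-- **Equal sector energies**: in every sector `(N, S^z = M)` the twisted uniformly-sourced torus and the
untwisted spirally-sourced torus have the same lowest energy (`L ≥ 3`). [cite: Watanabe2019, §2.2.1] -/
theorem minEnergyOn_szSector_dWaveSourceTorusTT'Twist (hL : 3 ≤ L) (t' U μ h : ℝ) (n : Fin 2 → ZMod L)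
    (N : ℕ) (M : ℝ) :
    (dWaveSourceTorusTT'Twist L t' U μ h n).minEnergyOn (szSector N M) =
      ((hubbardTorusTT' L 1 t' U - (μ : ℂ) • totalNumber) -
        (h : ℂ) • (spiralPairField L dWaveFormFactor n + (spiralPairField L dWaveFormFactor n)ᴴ)).minEnergyOn
        (szSector N M) := by
  rw [← conj_dWaveSourceTorusTT'Twist L hL, minEnergyOn_szSector_phaseGauge_conj]

/-- The twisted sourced torus is Hermitian (unit-modulus phases, real `t', U, μ, h`). [cite: KomaTasaki1994, §1] -/
theorem isHermitian_dWaveSourceTorusTT'Twist (t' U μ h : ℝ) (n : Fin 2 → ZMod L) :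
    (dWaveSourceTorusTT'Twist L t' U μ h n).IsHermitian := by
  have h1 : (hubbardTorusTT'Twist L t' U n).IsHermitian := by
    refine (magneticHubbardTorus_isHermitian (flatTwistConfig L n) 1 U).add ?_
    unfold Matrix.IsHermitian
    rw [conjTranspose_smul, (isHermitian_diagPeierlsHopping L (flatTwistDiagAmp L n)).eq, star_neg, Complex.star_def,
      Complex.conj_ofReal]
  have h2 : ((μ : ℂ) • (totalNumber : Matrix (Finset (Orb (FermionTorus 2 L))) (Finset (Orb (FermionTorus 2 L))) ℂ)).IsHermitian := by
    unfold Matrix.IsHermitian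
    rw [conjTranspose_smul, totalNumber_isHermitian.eq, Complex.star_def, Complex.conj_ofReal]
  have h3 : ((h : ℂ) • (pairField dWaveFormFactor L + (pairField dWaveFormFactor L)ᴴ)).IsHermitian := by
    unfold Matrix.IsHermitian
    rw [conjTranspose_smul, (Matrix.isHermitian_add_transpose_self _).eq, Complex.star_def, Complex.conj_ofReal]
  exact (h1.sub h2).sub h3

/-- Unitary invariance of the lowest variational energy on the whole space under site-phase conjugation
(generic in the site type, so that the `DecidableEq` instance inside `1` is the one the gauge lemmas carry).
[folklore] -/
private theorem minEnergyOn_top_phaseGauge_conj {Λ : Type*} [LinearOrder Λ] [Fintype Λ] (g : Λ → Circle)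
    (H : Matrix (Finset (Orb Λ)) (Finset (Orb Λ)) ℂ) :
    ((phaseGauge g)ᴴ * H * phaseGauge g).minEnergyOn ⊤ = H.minEnergyOn ⊤ :=
  Matrix.minEnergyOn_conjTranspose_mul_mul H (phaseGauge g) ⊤ (conjTranspose_phaseGauge_mul_self g)
    (phaseGauge_mul_conjTranspose_self g) (fun _ _ => Submodule.mem_top) (fun _ _ => Submodule.mem_top)

/-- The untwisted spirally-sourced torus is Hermitian (it is a unitary conjugate of the twisted one).
[cite: KomaTasaki1994, §1] -/
theorem isHermitian_spiralSourcedTorus (hL : 3 ≤ L) (t' U μ h : ℝ) (n : Fin 2 → ZMod L) :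
    ((hubbardTorusTT' L 1 t' U - (μ : ℂ) • totalNumber) -
        (h : ℂ) • (spiralPairField L dWaveFormFactor n + (spiralPairField L dWaveFormFactor n)ᴴ)).IsHermitian := by
  rw [← conj_dWaveSourceTorusTT'Twist L hL]
  exact Matrix.isHermitian_conjTranspose_mul_mul _ (isHermitian_dWaveSourceTorusTT'Twist L t' U μ h n)

/-- **Equal GRAND-CANONICAL ground energies** (`L ≥ 3`): `E₀(dWaveSourceTorusTT'Twist L t' U μ h n) =
E₀((H^{tt'} − μN) − h(Δ_d^{(2n)} + Δ_d^{(2n)†}))` — the sourced helicity chord of the card is the energy of the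
untwisted torus in a SPIRAL pair source. [cite: Watanabe2019, §2.2.1] -/
theorem groundEnergy_dWaveSourceTorusTT'Twist (hL : 3 ≤ L) (t' U μ h : ℝ) (n : Fin 2 → ZMod L) :
    (dWaveSourceTorusTT'Twist L t' U μ h n).groundEnergy =
      ((hubbardTorusTT' L 1 t' U - (μ : ℂ) • totalNumber) -
        (h : ℂ) • (spiralPairField L dWaveFormFactor n + (spiralPairField L dWaveFormFactor n)ᴴ)).groundEnergy := by
  haveI : Nonempty (Finset (Orb (FermionTorus 2 L))) := ⟨∅⟩
  have h1 := minEnergyOn_top_phaseGauge_conj (fun u : FermionTorus 2 L => boostPhase2 L n u.toTorusSite)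
    (dWaveSourceTorusTT'Twist L t' U μ h n)
  rw [conj_dWaveSourceTorusTT'Twist L hL] at h1
  rw [← Matrix.minEnergyOn_top_holds (isHermitian_dWaveSourceTorusTT'Twist L t' U μ h n),
    ← Matrix.minEnergyOn_top_holds (isHermitian_spiralSourcedTorus L hL t' U μ h n), h1]

/-- **Without source a flat twist with trivial holonomy is invisible** (`L ≥ 3`): at `h = 0` every sector energy
of the twisted torus equals that of `dWaveSourceTorusTT' L t' U μ 0` — the hypothesis `gauge0` of the
sourced-helicity bookkeeping is a theorem. [cite: Watanabe2019, §2.2.3] -/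
theorem minEnergyOn_szSector_dWaveSourceTorusTT'Twist_zero_source (hL : 3 ≤ L) (t' U μ : ℝ)
    (n : Fin 2 → ZMod L) (N : ℕ) (M : ℝ) :
    (dWaveSourceTorusTT'Twist L t' U μ 0 n).minEnergyOn (szSector N M) =
      (dWaveSourceTorusTT' L t' U μ 0).minEnergyOn (szSector N M) := by
  rw [minEnergyOn_szSector_dWaveSourceTorusTT'Twist L hL, dWaveSourceTorusTT'_eq, Complex.ofReal_zero, zero_smul,
    zero_smul, sub_zero]

/-- The grand-canonical form at `h = 0`: `E₀(twist n, h = 0) = E₀(dWaveSourceTorusTT' L t' U μ 0)` (`L ≥ 3`).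
[cite: Watanabe2019, §2.2.3] -/
theorem groundEnergy_dWaveSourceTorusTT'Twist_zero_source (hL : 3 ≤ L) (t' U μ : ℝ) (n : Fin 2 → ZMod L) :
    (dWaveSourceTorusTT'Twist L t' U μ 0 n).groundEnergy = (dWaveSourceTorusTT' L t' U μ 0).groundEnergy := by
  rw [groundEnergy_dWaveSourceTorusTT'Twist L hL, dWaveSourceTorusTT'_eq, Complex.ofReal_zero, zero_smul, zero_smul,
    sub_zero]

/-! ### Zero twist, symmetries -/

/-- At `n = 0` the twist gauge field is trivial. [cite: Watanabe2019, §2.2.1] -/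
theorem flatTwistConfig_zero : flatTwistConfig L 0 = 1 := by
  funext e
  show flatTwistConfig L 0 e = 1
  simp [flatTwistConfig]

/-- At `n = 0` the diagonal amplitudes are `1`. [cite: Watanabe2019, §2.2.1] -/
theorem flatTwistDiagAmp_zero : flatTwistDiagAmp L 0 = fun _ _ => 1 := by
  funext s x
  simp [flatTwistDiagAmp]

/-- **At `n = 0` the twisted sourced torus is `dWaveSourceTorusTT' L t' U μ h`** (`L ≥ 3`). [cite: KomaTasaki1994, §1] -/
theorem dWaveSourceTorusTT'Twist_zero_twist (hL : 3 ≤ L) (t' U μ h : ℝ) :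
    dWaveSourceTorusTT'Twist L t' U μ h 0 = dWaveSourceTorusTT' L t' U μ h := by
  rw [dWaveSourceTorusTT'Twist, hubbardTorusTT'Twist, flatTwistConfig_zero, flatTwistDiagAmp_zero,
    ← hubbardTorusTT'_eq_magneticHubbardTorus_add_diag hL, dWaveSourceTorusTT'_eq]

/-- The twisted sourced torus conserves `N↑` and `N↓`? No — the pair source changes `N` by two; it conserves the
spin sectors' `S^z` and the PARITY structure exactly as `dWaveSourceTorusTT'` does; what it shares verbatim with the
untwisted object is the sector-energy bookkeeping above. Here: the twisted HOPPING part conserves `N↑, N↓`.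
[cite: Watanabe2019, §2.2.1] -/
theorem preservesSectors_hubbardTorusTT'Twist (t' U : ℝ) (n : Fin 2 → ZMod L) :
    PreservesSectors (hubbardTorusTT'Twist L t' U n) :=
  (preservesSectors_magneticHubbardTorus (flatTwistConfig L n) 1 U).add
    ((preservesSectors_diagPeierlsHopping L (flatTwistDiagAmp L n)).smul _)

end Literature.MathematicalPhysics.QuantumLattice
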